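import Mathlib
import Literature.Probability.LatticeModels.IsingModel
import Literature.Probability.LatticeModels.ThermodynamicLimit
import Literature.Probability.LatticeModels.GKSInequalities
import HarnessLib

/-!
# Objects of the corner-transfer-matrix proof of `QuarterTurnAnchors` (route `ModularQuarterTurn`)

Route-posited vocabulary (D-0016) for item stmt-CriticalPhenomena-6495
(`Summit.CriticalPhenomena.Ising3DConformalLimit.Theses.ModularQuarterTurn.QuarterTurnAnchors`) of the
sub-problem `Ising3DConformalLimit`; the mathematics is in the companion files
`Theorems/ModularQuarterTurnQuarterTurnAnchors*.lean`, which import this module.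

THE CLAIM AND ITS PROOF.  In the box `{-L,…,L}³` with `+` boundary condition (zero field, any
inverse temperature `β`) let `P = {x₁ = 0 ≤ x₀}` and `E = {x₁ = 0, x₀ < 0}` be the two halves of the
plane `x₁ = 0`, `Pr σ η` the Gibbs probability of the plane configuration `(σ, η)`, and
`B σ' σ = [σ' = σ on the hinge x₀ = 0] · ∑_η √(Pr σ' η · Pr σ η)` (a Gram matrix on the configurations
of `P`).  Then `B = ctm⁴ / Z` where `ctm` is Baxter's corner transfer matrix of the closed quadrant
`Q = {0 ≤ x₀, 0 ≤ x₁}` (bonds on the two walls weighted `½`, on the hinge `¼`), indexed by the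
configurations of the wall `P` (the second wall `R P` is read through the lattice quarter turn
`R (y₀,y₁,y₂) = (-y₁,y₀,y₂)`); `ctm` is symmetric (diagonal mirror `x₀ ↔ x₁`) and positive
semidefinite (reflection positivity in the diagonal site plane, which no bond crosses), so the
positive fourth root `A = B^{1/4}` (Mathlib `cfc`) is `Z^{-1/4} ctm`, and the corner-transfer-matrix
trace formula gives `Tr (A D(g₃) A D(g₂) A D(g₁) A D(g₀)) = ⟨∏_k g_k ((ω ∘ Rᵏ)|_P)⟩`.

Contents (definitions only, with the elementary lemmas their well-formedness needs): the quarter turn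
`rotR` (LITERALLY the map `fun y => ![-(y 1), y 0, y 2]` of the route statement, hence not one of the
tree's generic signed permutations), its inverse `rotRinv`, the diagonal mirror `mirD`, the permutations
`rotEquiv`, `mirEquiv`; the closed first quadrant `quadQ`, the wall `wallP` (literally the `P` of the
statement), `sector`/`back` (angular position of a site); the quadrant bond weights `qind`, `nrot`,
`qwt`, `quadCoeff`, the corner energy `hQ`, the half-corner shares `loRho`, `aLow`; the wall restrictions
`resA`, `resB`, the corner weight `quadWeight`, the corner transfer matrix `ctm`, the mirror `mirQ` on
quadrant sites; the wall/quadrant read-offs `wallRes`, `quadRes` of a box configuration, the compatible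
quadruples `compatSet` and their gluing `glue4`; the lower half-plane `wallE` (literally `E`), the plane
marginal `prE` (literally `Pr`, at general `β`), the Gram kernel `bMat` (literally `B`), and the
transports `jn`, `toE` between `E` and `P` minus the hinge.

References: R. J. Baxter, J. Stat. Phys. 15 (1976) 485–503 and 17 (1977) 1–14 (corner transfer
matrices); S. Friedli, Y. Velenik, *Statistical Mechanics of Lattice Systems* (CUP 2017), §3.1 and
§10.3 (finite-volume Gibbs measures; reflection positivity); E. Fradkin, J. E. Moore, Phys. Rev. Lett.
97 (2006) 050404 (Gram form of reduced density matrices of Rokhsar–Kivelson states).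
-/

namespace Summit.CriticalPhenomena.Ising3DConformalLimit.QuarterTurnCTM

open Literature.Probability.LatticeModels Finset

/-! ### The quarter turn, its inverse, the diagonal mirror; boxes and the first quadrant -/

/-- The lattice quarter turn about the `x₂`-axis, `R (y₀,y₁,y₂) = (-y₁, y₀, y₂)` — literally the map
`fun y => ![-(y 1), y 0, y 2]` of the route statement `QuarterTurnAnchors`. [folklore] -/
def rotR : Site 3 → Site 3 := fun y => ![-(y 1), y 0, y 2]

/-- The inverse quarter turn `R⁻¹ (y₀,y₁,y₂) = (y₁, -y₀, y₂)`. [folklore] -/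
def rotRinv : Site 3 → Site 3 := fun y => ![y 1, -(y 0), y 2]

/-- The diagonal mirror `D (y₀,y₁,y₂) = (y₁, y₀, y₂)` in the site plane `x₀ = x₁`. [folklore] -/
def mirD : Site 3 → Site 3 := fun y => ![y 1, y 0, y 2]

/-- Coordinates of the quarter turn: `(R y)₀ = -y₁`. [folklore] -/
@[simp] theorem rotR_apply_zero (y : Site 3) : rotR y 0 = -(y 1) := rfl
/-- Coordinates of the quarter turn: `(R y)₁ = y₀`. [folklore] -/
@[simp] theorem rotR_apply_one (y : Site 3) : rotR y 1 = y 0 := rfl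
/-- Coordinates of the quarter turn: `(R y)₂ = y₂`. [folklore] -/
@[simp] theorem rotR_apply_two (y : Site 3) : rotR y 2 = y 2 := rfl
/-- Coordinates of the inverse quarter turn: `(R⁻¹ y)₀ = y₁`. [folklore] -/
@[simp] theorem rotRinv_apply_zero (y : Site 3) : rotRinv y 0 = y 1 := rfl
/-- Coordinates of the inverse quarter turn: `(R⁻¹ y)₁ = -y₀`. [folklore] -/
@[simp] theorem rotRinv_apply_one (y : Site 3) : rotRinv y 1 = -(y 0) := rfl
/-- Coordinates of the inverse quarter turn: `(R⁻¹ y)₂ = y₂`. [folklore] -/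
@[simp] theorem rotRinv_apply_two (y : Site 3) : rotRinv y 2 = y 2 := rfl
/-- Coordinates of the diagonal mirror: `(D y)₀ = y₁`. [folklore] -/
@[simp] theorem mirD_apply_zero (y : Site 3) : mirD y 0 = y 1 := rfl
/-- Coordinates of the diagonal mirror: `(D y)₁ = y₀`. [folklore] -/
@[simp] theorem mirD_apply_one (y : Site 3) : mirD y 1 = y 0 := rfl
/-- Coordinates of the diagonal mirror: `(D y)₂ = y₂`. [folklore] -/
@[simp] theorem mirD_apply_two (y : Site 3) : mirD y 2 = y 2 := rfl

/-- Two sites of `ℤ³` are equal iff their three coordinates agree. [folklore] -/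
theorem site_ext_iff (x y : Site 3) : x = y ↔ x 0 = y 0 ∧ x 1 = y 1 ∧ x 2 = y 2 := by
  constructor
  · rintro rfl; exact ⟨rfl, rfl, rfl⟩
  · rintro ⟨h0, h1, h2⟩
    funext i
    fin_cases i
    · exact h0
    · exact h1
    · exact h2

/-- `R ∘ R⁻¹ = id`. [folklore] -/
@[simp] theorem rotR_rotRinv (y : Site 3) : rotR (rotRinv y) = y := by
  rw [site_ext_iff]; simp
/-- `R⁻¹ ∘ R = id`. [folklore] -/
@[simp] theorem rotRinv_rotR (y : Site 3) : rotRinv (rotR y) = y := by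
  rw [site_ext_iff]; simp
/-- The diagonal mirror is an involution. [folklore] -/
@[simp] theorem mirD_mirD (y : Site 3) : mirD (mirD y) = y := by
  rw [site_ext_iff]; simp

/-- `R⁻¹` iterated is undone by `R` iterated. [folklore] -/
theorem rotR_iterate_rotRinv_iterate (n : ℕ) (y : Site 3) : rotR^[n] (rotRinv^[n] y) = y := by
  induction n generalizing y with
  | zero => rfl
  | succ n ih => rw [Function.iterate_succ_apply', Function.iterate_succ_apply, ih, rotR_rotRinv]

/-- The quarter turn as a permutation of `ℤ³`. [folklore] -/
def rotEquiv : Equiv.Perm (Site 3) := ⟨rotR, rotRinv, rotRinv_rotR, rotR_rotRinv⟩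

/-- The diagonal mirror as a permutation (an involution) of `ℤ³`. [folklore] -/
def mirEquiv : Equiv.Perm (Site 3) := ⟨mirD, mirD, mirD_mirD, mirD_mirD⟩

/-- `rotEquiv` acts as `rotR`. [folklore] -/
@[simp] theorem coe_rotEquiv : ⇑rotEquiv = rotR := rfl
/-- `mirEquiv` acts as `mirD`. [folklore] -/
@[simp] theorem coe_mirEquiv : ⇑mirEquiv = mirD := rfl

/-- Membership in the centred box of `ℤ³` in coordinates. [folklore] -/
theorem mem_box_three {L : ℕ} (x : Site 3) : x ∈ box 3 L ↔
    (-(L : ℤ) ≤ x 0 ∧ x 0 ≤ L) ∧ (-(L : ℤ) ≤ x 1 ∧ x 1 ≤ L) ∧ (-(L : ℤ) ≤ x 2 ∧ x 2 ≤ L) := by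
  rw [mem_box]
  simp [Fin.forall_fin_succ]

/-- The quarter turn preserves the box. [folklore] -/
@[simp] theorem rotR_mem_box_iff {L : ℕ} (x : Site 3) : rotR x ∈ box 3 L ↔ x ∈ box 3 L := by
  simp only [mem_box_three, rotR_apply_zero, rotR_apply_one, rotR_apply_two]
  omega

/-- The inverse quarter turn preserves the box. [folklore] -/
@[simp] theorem rotRinv_mem_box_iff {L : ℕ} (x : Site 3) : rotRinv x ∈ box 3 L ↔ x ∈ box 3 L := by
  simp only [mem_box_three, rotRinv_apply_zero, rotRinv_apply_one, rotRinv_apply_two]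
  omega

/-- The diagonal mirror preserves the box. [folklore] -/
@[simp] theorem mirD_mem_box_iff {L : ℕ} (x : Site 3) : mirD x ∈ box 3 L ↔ x ∈ box 3 L := by
  simp only [mem_box_three, mirD_apply_zero, mirD_apply_one, mirD_apply_two]
  omega

/-- Iterates of the inverse quarter turn preserve the box. [folklore] -/
@[simp] theorem rotRinv_iterate_mem_box_iff {L : ℕ} (k : ℕ) (x : Site 3) :
    rotRinv^[k] x ∈ box 3 L ↔ x ∈ box 3 L := by
  induction k generalizing x with
  | zero => rfl
  | succ k ih => rw [Function.iterate_succ_apply', rotRinv_mem_box_iff, ih]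

/-- The closed first quadrant of the box, `{x ∈ box 3 L | 0 ≤ x₀ ∧ 0 ≤ x₁}` (the corner of Baxter's
corner transfer matrix). [folklore] -/
noncomputable def quadQ (L : ℕ) : Finset (Site 3) := (box 3 L).filter fun x => 0 ≤ x 0 ∧ 0 ≤ x 1

/-- The wall `P = {x ∈ box 3 L | x₁ = 0 ∧ 0 ≤ x₀}` — literally the half-plane `P` of the route
statement. [folklore] -/
noncomputable def wallP (L : ℕ) : Finset (Site 3) := (box 3 L).filter fun x => x 1 = 0 ∧ 0 ≤ x 0

/-- Membership in the closed first quadrant. [folklore] -/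
theorem mem_quadQ {L : ℕ} {x : Site 3} : x ∈ quadQ L ↔ x ∈ box 3 L ∧ 0 ≤ x 0 ∧ 0 ≤ x 1 := by
  simp [quadQ]

/-- Membership in the wall `P`. [folklore] -/
theorem mem_wallP {L : ℕ} {x : Site 3} : x ∈ wallP L ↔ x ∈ box 3 L ∧ x 1 = 0 ∧ 0 ≤ x 0 := by
  simp [wallP]

/-- The quadrant lies in the box. [folklore] -/
theorem quadQ_subset_box (L : ℕ) : quadQ L ⊆ box 3 L := Finset.filter_subset _ _

/-- The wall `P` lies in the quadrant. [folklore] -/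
theorem wallP_subset_quadQ (L : ℕ) : wallP L ⊆ quadQ L := by
  intro x hx
  rw [mem_wallP] at hx
  rw [mem_quadQ]
  exact ⟨hx.1, hx.2.2, hx.2.1.ge⟩

/-- The second wall of the quadrant: `R P ⊆ Q`. [folklore] -/
theorem rotR_mem_quadQ_of_mem_wallP {L : ℕ} {x : Site 3} (hx : x ∈ wallP L) : rotR x ∈ quadQ L := by
  rw [mem_wallP] at hx
  rw [mem_quadQ, rotR_mem_box_iff]
  refine ⟨hx.1, ?_, ?_⟩ <;> simp [hx.2.1, hx.2.2]

/-- The mirror preserves the quadrant. [folklore] -/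
@[simp] theorem mirD_mem_quadQ_iff {L : ℕ} (x : Site 3) : mirD x ∈ quadQ L ↔ x ∈ quadQ L := by
  simp only [mem_quadQ, mirD_mem_box_iff, mirD_apply_zero, mirD_apply_one]
  tauto

/-- The sector `k ∈ {0,1,2,3}` of a site: `y ∈ Rᵏ Q₀'` for the half-open angular sectors about the
`x₂`-axis. [folklore] -/
noncomputable def sector (y : Site 3) : ℕ :=
  if 0 ≤ y 0 ∧ 0 ≤ y 1 then 0 else if 0 ≤ y 1 then 1 else if y 0 < 0 then 2 else 3

/-- The representative of a site in the closed first quadrant: `back y = R^{-sector y} y`. [folklore] -/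
noncomputable def back (y : Site 3) : Site 3 := rotRinv^[sector y] y

/-- There are four sectors. [folklore] -/
theorem sector_lt_four (y : Site 3) : sector y < 4 := by
  unfold sector; split_ifs <;> omega

/-- `R^{sector y} (back y) = y`. [folklore] -/
theorem rotR_iterate_sector_back (y : Site 3) : rotR^[sector y] (back y) = y :=
  rotR_iterate_rotRinv_iterate _ _

/-- The sector representative has nonnegative first two coordinates. [folklore] -/
theorem back_nonneg (y : Site 3) : 0 ≤ back y 0 ∧ 0 ≤ back y 1 := by
  unfold back sector
  by_cases h0 : 0 ≤ y 0 ∧ 0 ≤ y 1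
  · simp [h0]
  · rw [if_neg h0]
    by_cases h1 : 0 ≤ y 1
    · simp only [if_pos h1, Function.iterate_one, rotRinv_apply_zero, rotRinv_apply_one]
      omega
    · rw [if_neg h1]
      by_cases h2 : y 0 < 0
      · rw [if_pos h2]
        show 0 ≤ rotRinv (rotRinv y) 0 ∧ 0 ≤ rotRinv (rotRinv y) 1
        simp only [rotRinv_apply_zero, rotRinv_apply_one]
        omega
      · rw [if_neg h2]
        show 0 ≤ rotRinv (rotRinv (rotRinv y)) 0 ∧ 0 ≤ rotRinv (rotRinv (rotRinv y)) 1
        simp only [rotRinv_apply_zero, rotRinv_apply_one]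
        omega

/-- The sector representative of a box site lies in the closed first quadrant. [folklore] -/
theorem back_mem_quadQ {L : ℕ} {y : Site 3} (hy : y ∈ box 3 L) : back y ∈ quadQ L := by
  rw [mem_quadQ]
  refine ⟨?_, back_nonneg y⟩
  unfold back
  rwa [rotRinv_iterate_mem_box_iff]

/-! ### Corner energies, the corner transfer matrix, wall read-offs, the plane marginal -/

section Objects

variable (L : ℕ) (β : ℝ)

/-- The indicator (`1`/`0`) that every endpoint of the bond `{x, y}` lying in the box lies in the
closed first quadrant `{0 ≤ x₀, 0 ≤ x₁}` (endpoints outside the box carry the frozen `+` spin and are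
unconstrained). [folklore] -/
noncomputable def qind (x y : Site 3) : ℝ :=
  if (x ∈ box 3 L → 0 ≤ x 0 ∧ 0 ≤ x 1) ∧ (y ∈ box 3 L → 0 ≤ y 0 ∧ 0 ≤ y 1) then 1 else 0

/-- The quadrant indicator is symmetric in the two endpoints. [folklore] -/
theorem qind_comm (x y : Site 3) : qind L x y = qind L y x := by
  unfold qind; exact if_congr and_comm rfl rfl

/-- The number of quarter turns `Rᵏ`, `k < 4`, carrying the bond `{x, y}` into the first quadrant
(as a real number): `1` for a bond interior to a quadrant, `2` for a wall bond, `4` for a hinge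
bond. [folklore] -/
noncomputable def nrot (x y : Site 3) : ℝ := ∑ k : Fin 4, qind L (rotR^[k] x) (rotR^[k] y)

/-- The corner-transfer-matrix weight of the bond `{x, y}` in the first quadrant: `1 / nrot` if the
bond lies in the quadrant (so walls are weighted `½` and the hinge `¼`), `0` otherwise (Baxter 1976).
[folklore] -/
noncomputable def qwt (x y : Site 3) : ℝ := qind L x y * (nrot L x y)⁻¹

/-- `nrot` is symmetric in the two endpoints. [folklore] -/
theorem nrot_comm (x y : Site 3) : nrot L x y = nrot L y x := by
  unfold nrot; simp_rw [qind_comm L (rotR^[_] x)]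

/-- The quadrant bond weight is symmetric in the two endpoints. [folklore] -/
theorem qwt_comm (x y : Site 3) : qwt L x y = qwt L y x := by
  unfold qwt; rw [nrot_comm, qind_comm]

/-- The quadrant weight of an unordered bond. [folklore] -/
noncomputable def quadCoeff : Sym2 (Site 3) → ℝ := Sym2.lift ⟨qwt L, qwt_comm L⟩

/-- The quadrant weight of the bond `s(x, y)` is `qwt x y`. [folklore] -/
@[simp] theorem quadCoeff_mk (x y : Site 3) : quadCoeff L s(x, y) = qwt L x y := rfl

/-- The energy of the closed first quadrant (corner): `hQ L ω = ∑_{e} quadCoeff e · σ_e` over the bonds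
touching the box, i.e. the bonds of the quadrant with walls weighted `½` and the hinge `¼`; the
Boltzmann weight of Baxter's corner transfer matrix is `exp (β hQ)` (Baxter 1976; Friedli–Velenik
2017 §3.1 for `H = -∑ σ_e`). [folklore] -/
noncomputable def hQ (ω : SpinConfig (Site 3)) : ℝ :=
  ∑ e ∈ edgesTouching (zdGraph 3) (box 3 L), quadCoeff L e * bondSpin ω e

/-- The half-quadrant share of a bond: `1` strictly below the diagonal plane `x₀ = x₁`, `½` on it, `0`
strictly above (only box endpoints count), exactly as in the tree's half-space decomposition
`exists_neg_mul_isingHamiltonian_eq_add_comp` (Friedli–Velenik 2017, Example 10.9). [folklore] -/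
noncomputable def loRho (x y : Site 3) : ℝ :=
  ((if (x ∈ box 3 L → x 1 ≤ x 0) ∧ (y ∈ box 3 L → y 1 ≤ y 0) then 1 else 0) +
    (if (x ∈ box 3 L → x 0 ≤ x 1) ∧ (y ∈ box 3 L → y 0 ≤ y 1) then 0 else 1)) / 2

/-- The half-quadrant share is symmetric in the two endpoints. [folklore] -/
theorem loRho_comm (x y : Site 3) : loRho L x y = loRho L y x := by
  unfold loRho
  congr 2 <;> exact if_congr and_comm rfl rfl

/-- The energy of the lower closed half-quadrant `{x₁ ≤ x₀} ∩ Q` (diagonal bonds weighted `½`):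
`aLow L ω = ∑_e quadCoeff e · loRho e · σ_e`. [folklore] -/
noncomputable def aLow (ω : SpinConfig (Site 3)) : ℝ :=
  ∑ e ∈ edgesTouching (zdGraph 3) (box 3 L),
    Sym2.lift ⟨fun x y => qwt L x y * loRho L x y,
      fun x y => by dsimp only; rw [qwt_comm, loRho_comm]⟩ e * bondSpin ω e

/-- Restriction of a quadrant configuration to the wall `P`. [folklore] -/
def resA (κ : ↥(quadQ L) → ℤˣ) : ↥(wallP L) → ℤˣ := fun x => κ ⟨x.1, wallP_subset_quadQ L x.2⟩

/-- Restriction of a quadrant configuration to the second wall `R P`, transported back to `P` by the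
quarter turn. [folklore] -/
def resB (κ : ↥(quadQ L) → ℤˣ) : ↥(wallP L) → ℤˣ :=
  fun x => κ ⟨rotR x.1, rotR_mem_quadQ_of_mem_wallP x.2⟩

/-- The corner Boltzmann weight `exp (β · hQ)` of a configuration of the closed first quadrant, the spins
off the quadrant frozen to `+` (only those outside the box are seen by `hQ`). [folklore] -/
noncomputable def quadWeight (κ : ↥(quadQ L) → ℤˣ) : ℝ :=
  Real.exp (β * hQ L (glue (quadQ L) κ .plus))

/-- **Baxter's corner transfer matrix** of the closed first quadrant of the box `{-L,…,L}³` with `+`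
boundary condition: `ctm s s' = ∑ {exp (β hQ κ) : κ on the quadrant, κ|_P = s, κ|_{RP} ∘ R = s'}`,
a matrix indexed by the configurations of the wall `P` (Baxter 1976, here in three dimensions with
the hinge axis `x₂`). [folklore] -/
noncomputable def ctm : Matrix (↥(wallP L) → ℤˣ) (↥(wallP L) → ℤˣ) ℝ :=
  Matrix.of fun s s' => ∑ κ : ↥(quadQ L) → ℤˣ,
    if resA L κ = s ∧ resB L κ = s' then quadWeight L β κ else 0

/-- Entries of the corner transfer matrix. [folklore] -/
theorem ctm_apply (s s' : ↥(wallP L) → ℤˣ) : ctm L β s s' =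
    ∑ κ : ↥(quadQ L) → ℤˣ, if resA L κ = s ∧ resB L κ = s' then quadWeight L β κ else 0 := rfl

/-- The diagonal mirror restricted to the (mirror-symmetric) closed first quadrant. [folklore] -/
noncomputable def mirQ : ↥(quadQ L) ≃ ↥(quadQ L) :=
  volEquiv mirEquiv (fun x => (mirD_mem_quadQ_iff (L := L) x).symm)

/-- The `k`-th wall configuration of a box configuration `τ`: the spins `x ↦ ω (Rᵏ x)` on the wall `P`
(`ω = τ` glued with `+` outside the box) — for `k = 0,1,2,3` the restrictions of `ω ∘ Rᵏ` to `P`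
appearing in the route statement. [folklore] -/
noncomputable def wallRes (k : ℕ) (τ : ↥(box 3 L) → ℤˣ) : ↥(wallP L) → ℤˣ :=
  fun x => glue (box 3 L) τ .plus (rotR^[k] x.1)

/-- The `k`-th quadrant configuration of a box configuration: `x ↦ ω (Rᵏ x)` on the closed first
quadrant, i.e. the configuration on the quadrant `Rᵏ Q` transported back to `Q`. [folklore] -/
noncomputable def quadRes (k : ℕ) (τ : ↥(box 3 L) → ℤˣ) : ↥(quadQ L) → ℤˣ :=
  fun x => glue (box 3 L) τ .plus (rotR^[k] x.1)

/-- The compatible quadruples of quadrant configurations: consecutive ones agree along the shared wall,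
`(κ k)|_{RP} ∘ R = (κ (k+1))|_P`. [folklore] -/
noncomputable def compatSet : Finset (Fin 4 → (↥(quadQ L) → ℤˣ)) :=
  Finset.univ.filter fun κ => ∀ k : Fin 4, resB L (κ k) = resA L (κ (k + 1))

/-- Gluing a quadruple of quadrant configurations into a box configuration (each site read off in the
quadrant of its sector). [folklore] -/
noncomputable def glue4 (κ : Fin 4 → (↥(quadQ L) → ℤˣ)) : ↥(box 3 L) → ℤˣ :=
  fun y => κ ⟨sector y.1, sector_lt_four y.1⟩ ⟨back y.1, back_mem_quadQ y.2⟩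

/-- Membership in the set of compatible quadruples. [folklore] -/
theorem mem_compatSet {κ : Fin 4 → (↥(quadQ L) → ℤˣ)} :
    κ ∈ compatSet L ↔ ∀ k : Fin 4, resB L (κ k) = resA L (κ (k + 1)) := by
  simp [compatSet]

/-- The lower half-plane `E = {x ∈ box | x₁ = 0, x₀ < 0}` of the route statement. [folklore] -/
noncomputable def wallE : Finset (Site 3) := (box 3 L).filter fun x => x 1 = 0 ∧ x 0 < 0

/-- Membership in the lower half-plane `E`. [folklore] -/
theorem mem_wallE {x : Site 3} : x ∈ wallE L ↔ x ∈ box 3 L ∧ x 1 = 0 ∧ x 0 < 0 := by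
  simp [wallE]

/-- The half turn `R²` maps `P` minus the hinge into `E`. [folklore] -/
theorem rotR_rotR_mem_wallE {x : Site 3} (hx : x ∈ wallP L) (h0 : x 0 ≠ 0) : rotR (rotR x) ∈ wallE L := by
  rw [mem_wallP] at hx
  obtain ⟨hb, h1, h0'⟩ := hx
  rw [mem_wallE, rotR_mem_box_iff, rotR_mem_box_iff]
  simp only [rotR_apply_zero, rotR_apply_one]
  exact ⟨hb, by omega, by omega⟩

/-- The half turn `R²` maps `E` into `P` (off the hinge). [folklore] -/
theorem rotR_rotR_mem_wallP {y : Site 3} (hy : y ∈ wallE L) : rotR (rotR y) ∈ wallP L := by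
  rw [mem_wallE] at hy
  obtain ⟨hb, h1, h0⟩ := hy
  rw [mem_wallP, rotR_mem_box_iff, rotR_mem_box_iff]
  simp only [rotR_apply_zero, rotR_apply_one]
  exact ⟨hb, by omega, by omega⟩

/-- The plane marginal `Pr σ η` of the route statement: the `+`-boundary Gibbs probability (zero field,
inverse temperature `β`) that the configuration is `σ` on `P` and `η` on `E`. [folklore] -/
noncomputable def prE (σ : ↥(wallP L) → ℤˣ) (η : ↥(wallE L) → ℤˣ) : ℝ :=
  isingExpect (zdGraph 3) (box 3 L) β 0 BoundaryCondition.plus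
    (fun ω => (∏ x : ↥(wallP L), if ω x.1 = σ x then (1:ℝ) else 0) *
      ∏ y : ↥(wallE L), if ω y.1 = η y then (1:ℝ) else 0)

/-- The Gram ("full turn") kernel `B` of the route statement: `B σ' σ = [σ' = σ on the hinge] ·
∑_η √(Pr σ' η · Pr σ η)`. [folklore] -/
noncomputable def bMat : Matrix (↥(wallP L) → ℤˣ) (↥(wallP L) → ℤˣ) ℝ :=
  Matrix.of fun σ' σ => if (∀ x : ↥(wallP L), x.1 0 = 0 → σ' x = σ x) then
    ∑ η : ↥(wallE L) → ℤˣ, Real.sqrt (prE L β σ' η * prE L β σ η) else 0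

/-- Merging a wall configuration `σ` (hinge part) with a lower-half-plane configuration `η` (transported
by the half turn) into a wall configuration. [folklore] -/
noncomputable def jn (σ : ↥(wallP L) → ℤˣ) (η : ↥(wallE L) → ℤˣ) : ↥(wallP L) → ℤˣ :=
  fun x => if h : x.1 0 = 0 then σ x else η ⟨rotR (rotR x.1), rotR_rotR_mem_wallE L x.2 h⟩

/-- Transporting a wall configuration to the lower half-plane by the half turn. [folklore] -/
noncomputable def toE (ν : ↥(wallP L) → ℤˣ) : ↥(wallE L) → ℤˣ :=
  fun y => ν ⟨rotR (rotR y.1), rotR_rotR_mem_wallP L y.2⟩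

end Objects

end Summit.CriticalPhenomena.Ising3DConformalLimit.QuarterTurnCTM
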